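import Summits.ResolutionOfSingularities.ResolutionOfSingularities.Theorems.PurelyInseparableDim4E2OfCJSLocalize
import Summits.ResolutionOfSingularities.ResolutionOfSingularities.Theorems.PurelyInseparableDim4PointStalk
import Summits.ResolutionOfSingularities.ResolutionOfSingularities.Theorems.HilbertSamuelEliminationSigmaMaxModificationsCorridor3WLadderLocalChainsLocalize
import Literature.AlgebraicGeometry.Resolution.CoefficientIdealRestriction
import Literature.AlgebraicGeometry.Resolution.SncSaturatedCentre
import Literature.AlgebraicGeometry.Resolution.PermissibleCentres
import HarnessLib
import HarnessLib.Audit.Tags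

/-!
# F4-I(3,3) from CJS — row (M-b) LOCALISATION, PROVED modulo the strict-transform atom (M-c)
# (cell `res-dim4-pi`, WORD #59 (a): seat p-7 g2 «TAKE M-b»; holder res-dim4-p-2 g2; (M-c) res-dim4-p-5 g2; K p-9 g2)

[OURS · counted 0 · AI work weaker than expert review.]  NOTHING here proves `NoIsolatedTrap 3 3` or resolution of
singularities in dimension ≥ 4 / characteristic `p`.

Row (M-b) `E2OfCJS.LocalizationRow` (`…E2OfCJSLocalize`, p665567): the GLOBAL model of a frame chain
(`E2OfCJS.globalModel`: ambients `Z i`, marked ideals `M i` of multiplicity `3` read as `(z³ + (c i).F)·𝒪` on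
open-immersion charts `φ i : 𝔸⁵ ⟶ Z i`, closed points `x i`, point blow-ups `π i : Z (i+1) ⟶ Z i`) LOCALISES to the
data of `ModelRow`.  This file proves it from ONE geometric atom, consumed as a hypothesis in exactly the shape agreed
on the cell bus (20:49Z): **(M-c)** «the restriction of `π i` to the subscheme cut by the transformed marked ideal
maps to the hypersurface `X i = V((M i).ideal)` and IS its blow-up at the closed point over `x i`» — res-dim4-p-5
g2's brick.  Everything else is the tree's W4.2 localisation kit (res-hironaka, `…Corridor3WLadderLocalPointBlowup` /
`…LocalChainsLocalize`): `S i := Spec 𝒪_{X_i, x̃ i}`; `B i := X_{i+1} ×_{X_i} Spec 𝒪_{X_i, x̃ i}`, a blow-up of the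
closed point (`Moving.isBlowup_pullback_snd_fromSpecStalk_singleton`: blow-ups commute with the flat base change
`Spec 𝒪_{X,x} → X`); `b i` the lift of `x̃ (i+1)` (`Moving.exists_lift_pullback_fromSpecStalk`), CLOSED, with
`𝒪_{B_i, b_i} ≅ 𝒪_{X_{i+1}, x̃_{i+1}}` (`isIso_stalkMap_pullback_fst_fromSpecStalk`) whence the link
`IsLocalSchemeAt (S (i+1)) (pt (i+1)) (B i) (b i)`; and the PRESENTATIONS
`𝒪_{X_i, x̃ i} ≅ 𝒪_{Z_i, x i} ⧸ ((M i).ideal)_{x i} ≅ 𝒪_{𝔸⁵, 0} ⧸ (z³ + (c i).F)_0 = HypStalk K (c i).F`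
(closed-subscheme stalks: `ker_stalkMap_subschemeι`; open-immersion chart: typ-3's
`Equimultiple.exists_stalkIso_hypSheaf_of_zigzag`).

* §1 `exists_hypersurfaceStalkIso` — the presentation of the hypersurface stalk by the chart;
* §2 `localizationRow_of_strictTransform : (M-c) → LocalizationRow`.

bears_on: LADDER-RESOLUTION:D157-DOOR2 (res-dim4-pi · F4-I(3,3) · CJS dictionary · row M-b).  Supports
stmt-ResolutionOfSingularities-16155 (helper).
-/

set_option linter.dupNamespace false -- mandated namespace of this single-conjunct summit

noncomputable section

open CategoryTheory CategoryTheory.Limits AlgebraicGeometry TopologicalSpace IsLocalRing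
open Literature.AlgebraicGeometry.Resolution
open Literature.AlgebraicGeometry.Resolution.Hauser2010
open Literature.AlgebraicGeometry.Resolution.AffinePointBlowup (P A ξ)
open Literature.AlgebraicGeometry.CossartJannsenSaito2020
open Scheme.IdealSheafData
open Summit.ResolutionOfSingularities.ResolutionOfSingularities.Theorems.SigmaMaxModificationsCorridor3.Moving

namespace Summit.ResolutionOfSingularities.ResolutionOfSingularities.Theorems.PIDim4

namespace E2OfCJS

open RidgeBudget (ebar)

/-! ## §1 The hypersurface stalk is presented by the chart -/

section Presentation

variable {K : Type} [Field K]

/-- **The origin of the chart lies on the hypersurface**: `ξ ∈ V((z³ + F)·𝒪)` when `ordZero F = 3`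
(the germ `z³ + F` lies in the maximal ideal). [folklore] -/
theorem ξ_mem_support_hypSheaf {F : MvPolynomial (Fin 4) K} (hF : ordZero F = (3 : ℕ∞)) :
    ξ 4 K ∈ (hypSheaf 3 F).support := by
  rw [mem_support_iff_stalkIdeal_ne_top, stalkIdeal_hypSheaf_ξ]
  intro htop
  have h1 : hypGerm K F ∈ maximalIdeal (originStalk K) :=
    hypGerm_mem_maximalIdeal K F (constantCoeff_eq_zero_of_ordZero_eq_three hF)
  have h2 : (1 : originStalk K) ∈ Ideal.span {hypGerm K F} := by rw [htop]; exact Submodule.mem_top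
  rw [Ideal.mem_span_singleton] at h2
  exact (maximalIdeal.isMaximal (originStalk K)).ne_top
    (Ideal.eq_top_of_isUnit_mem _ h1 (isUnit_of_dvd_one h2))

/-- **The marked point lies on the hypersurface**: with a chart `φ : 𝔸⁵ ⟶ Z` at `x` on which `M.ideal` reads
`(z³ + F)·𝒪`, `x ∈ V(M.ideal)`. [folklore] -/
theorem mem_support_of_chart {Z : Scheme.{0}} (M : MarkedIdeal Z) {x : Z} (φ : P 4 K ⟶ Z)
    (hφ : φ (ξ 4 K) = x) {F : MvPolynomial (Fin 4) K} (hF : ordZero F = (3 : ℕ∞))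
    (hM : M.ideal.comap φ = hypSheaf 3 F) : x ∈ M.ideal.support := by
  have h := ξ_mem_support_hypSheaf (K := K) hF
  rw [← hM] at h
  have h' : ξ 4 K ∈ ((M.ideal.comap φ).support : Set (P 4 K)) := h
  rw [support_comap] at h'
  rw [← hφ]
  exact h'

/-- **PRESENTATION OF THE HYPERSURFACE STALK.** For the closed subscheme `X = V(M.ideal) ⊂ Z` and a point `y` of
`X` over the chart's centre `x = φ 0` (`M.ideal.comap φ = (z³ + F)·𝒪`):
`𝒪_{X, y} ≅ 𝒪_{𝔸⁵, 0} ⧸ (z³ + F)_0 = HypStalk K F` — the closed immersion's stalk map is surjective with kernel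
`(M.ideal)_x` (`ker_stalkMap_subschemeι`), and the chart identifies `(𝒪_{Z,x}, (M.ideal)_x)` with
`(𝒪_{𝔸⁵,0}, (z³+F)_0)` (typ-3's `Equimultiple.exists_stalkIso_hypSheaf_of_zigzag`).
[cite: BierstoneGrigorievMilmanWlodarczyk2011, Lemma 8.0.3 (2)] -/
theorem exists_hypersurfaceStalkIso {Z : Scheme.{0}} (M : MarkedIdeal Z) {x : Z} (φ : P 4 K ⟶ Z)
    [IsOpenImmersion φ] (hφ : φ (ξ 4 K) = x) (s : State K) (hM : M.ideal.comap φ = hypSheaf 3 s.F)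
    (y : M.ideal.subscheme) (hy : M.ideal.subschemeι y = x) :
    Nonempty (M.ideal.subscheme.presheaf.stalk y ≅ HypStalk K s.F) := by
  -- the ambient stalk and its ideal, read on the chart
  have hM' : M.ideal.comap φ = (hypSheaf 3 s.F).comap (𝟙 (P 4 K)) := by rw [comap_id]; exact hM
  obtain ⟨e, he⟩ := Equimultiple.exists_stalkIso_hypSheaf_of_zigzag (p := 3) φ (𝟙 (P 4 K)) (ξ 4 K) hφ rfl M s hM'
  -- the subscheme stalk is the quotient of the ambient stalk by the stalk ideal
  subst hy
  have hsurj : Function.Surjective (M.ideal.subschemeι.stalkMap y).hom :=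
    M.ideal.subschemeι.stalkMap_surjective y
  have hker : RingHom.ker (M.ideal.subschemeι.stalkMap y).hom =
      stalkIdeal M.ideal (M.ideal.subschemeι y) := ker_stalkMap_subschemeι M.ideal y
  let e₁ : (Z.presheaf.stalk (M.ideal.subschemeι y) ⧸ stalkIdeal M.ideal (M.ideal.subschemeι y)) ≃+*
      M.ideal.subscheme.presheaf.stalk y :=
    (Ideal.quotEquivOfEq hker.symm).trans (RingHom.quotientKerEquivOfSurjective hsurj)
  have hcoe : (e.commRingCatIsoToRingEquiv : Z.presheaf.stalk (M.ideal.subschemeι y) →+*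
      (P 4 K).presheaf.stalk (ξ 4 K)) = e.hom.hom := RingHom.ext fun _ => rfl
  let e₂ : (Z.presheaf.stalk (M.ideal.subschemeι y) ⧸ stalkIdeal M.ideal (M.ideal.subschemeι y)) ≃+*
      ((P 4 K).presheaf.stalk (ξ 4 K) ⧸ stalkIdeal (hypSheaf 3 s.F) (ξ 4 K)) :=
    Ideal.quotientEquiv _ _ e.commRingCatIsoToRingEquiv (by rw [hcoe, he])
  exact ⟨(e₁.symm.trans e₂).toCommRingCatIso⟩

end Presentation

/-! ## §2 (M-c) ⇒ (M-b): the localisation of the global model -/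

section Localize

/-- A point of a closed subscheme whose image is a closed point is a closed point. [folklore] -/
theorem isClosed_singleton_of_subschemeι {Z : Scheme.{0}} (I : Z.IdealSheafData) (y : I.subscheme)
    (hy : IsClosed ({I.subschemeι y} : Set Z)) : IsClosed ({y} : Set I.subscheme) := by
  have hinj : Function.Injective I.subschemeι.base := I.subschemeι.isEmbedding.injective
  have h : ({y} : Set I.subscheme) = I.subschemeι.base ⁻¹' {I.subschemeι y} := by
    ext z
    simp only [Set.mem_singleton_iff, Set.mem_preimage]
    exact ⟨fun h => by rw [h], fun h => hinj h⟩
  rw [h]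
  exact hy.preimage I.subschemeι.continuous

/-- **THE SHAPE OF (M-c) CONSUMED HERE** (res-dim4-p-5 g2's brick «strict transform = blow-up of the
hypersurface», agreed on the cell bus 2026-08-28 20:49Z): for a marked ideal `M` of multiplicity `3` on a locally
noetherian `Z`, read as `(z³ + F)·𝒪` (`ordZero F = 3`) on an open-immersion chart `φ : 𝔸⁵ ⟶ Z` at the closed point
`x`, a blowing up `π : Z' ⟶ Z` of `x` and the transformed marked ideal `M' = M.transform π 𝓘_x`: the inclusion
`V(M'.ideal) ⟶ Z'` followed by `π` factors through a morphism `ρ : V(M'.ideal) ⟶ V(M.ideal)` which is a blowing up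
of `V(M.ideal)` at its (closed) point over `x`.  Stated as a `Prop`-valued abbreviation ONLY to keep the signature
of `localizationRow_of_strictTransform` readable; it is a HYPOTHESIS there, not asserted.
(OURS — parameterless `Prop`, deliberately untagged; not asserted.) -/
def StrictTransformBlowup : Prop :=
  ∀ (K : Type) [Field K] (F : MvPolynomial (Fin 4) K) (Z Z' : Scheme.{0}) [IsLocallyNoetherian Z]
    [IsLocallyNoetherian Z'] (M : MarkedIdeal Z) (M' : MarkedIdeal Z') (x : Z) (hx : IsClosed ({x} : Set Z))
    (φ : P 4 K ⟶ Z) [IsOpenImmersion φ] (π : Z' ⟶ Z),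
    M.mult = 3 → ordZero F = (3 : ℕ∞) → φ (ξ 4 K) = x → M.ideal.comap φ = hypSheaf 3 F →
    IsBlowup π (vanishingIdeal ⟨{x}, hx⟩) → M' = M.transform π (vanishingIdeal ⟨{x}, hx⟩) →
    ∃ ρ : M'.ideal.subscheme ⟶ M.ideal.subscheme,
      ρ ≫ M.ideal.subschemeι = M'.ideal.subschemeι ≫ π ∧
      ∀ (y : M.ideal.subscheme) (hy : IsClosed ({y} : Set M.ideal.subscheme)), M.ideal.subschemeι y = x →
        IsBlowup ρ (vanishingIdeal ⟨{y}, hy⟩)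

/-- **ROW (M-b) FROM (M-c): THE GLOBAL MODEL LOCALISES.**  With `X i = V((M i).ideal)` and `x̃ i` its point over
`x i`: `S i = Spec 𝒪_{X_i, x̃ i}` (local at the closed point), `B i = X_{i+1} ×_{X_i} Spec 𝒪_{X_i, x̃ i}` — the
blow-up of the closed point, since `X_{i+1} ⟶ X_i` is the blow-up of `x̃ i` by (M-c) and blow-ups commute with
the flat base change `Spec 𝒪_{X,x} ⟶ X` — `b i` the lift of `x̃ (i+1)`, closed, with `𝒪_{B_i,b_i} ≅ 𝒪_{X_{i+1},
x̃_{i+1}}` (so `S (i+1)` is the local scheme of `B i` at `b i`), and every local ring presented by the frame's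
polynomial through the chart (`exists_hypersurfaceStalkIso`).
[cite: CossartJannsenSaito2020, p. 107, Def. 6.38 / 6.39] [cite: GortzWedhorn2020, Prop. 13.91 (2)] -/
theorem localizationRow_of_strictTransform (hMc : StrictTransformBlowup) : LocalizationRow := by
  intro K _ _ _ _ c hc Z hZ hJ M x hx φ hφoi π hall
  have hmult : ∀ i, (M i).mult = 3 := fun i => (hall i).1
  have hφ : ∀ i, (φ i) (ξ 4 K) = x i := fun i => (hall i).2.1
  have hMφ : ∀ i, (M i).ideal.comap (φ i) = hypSheaf 3 (c i).F := fun i => (hall i).2.2.1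
  have hπ : ∀ i, IsBlowup (π i) (vanishingIdeal ⟨{x i}, hx i⟩) := fun i => (hall i).2.2.2.1
  have hMsucc : ∀ i, M (i + 1) = (M i).transform (π i) (vanishingIdeal ⟨{x i}, hx i⟩) :=
    fun i => (hall i).2.2.2.2.1
  have hπx : ∀ i, (π i) (x (i + 1)) = x i := fun i => (hall i).2.2.2.2.2
  have hord : ∀ i, ordZero (c i).F = (3 : ℕ∞) := fun i => (hc i).2.2.1
  -- the hypersurfaces `X i = V((M i).ideal)` and their marked (closed) points `x̃ i` over `x i`
  have hxmem : ∀ i, x i ∈ (M i).ideal.support := fun i =>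
    mem_support_of_chart (M i) (φ i) (hφ i) (hord i) (hMφ i)
  let xt : ∀ i, ↥((M i).ideal.subscheme) := fun i => ⟨x i, hxmem i⟩
  have hιxt : ∀ i, (M i).ideal.subschemeι (xt i) = x i := fun i => rfl
  have hxtcl : ∀ i, IsClosed ({xt i} : Set ↥((M i).ideal.subscheme)) := fun i =>
    isClosed_singleton_of_subschemeι _ _ (by rw [hιxt]; exact hx i)
  haveI hXln : ∀ i, IsLocallyNoetherian (M i).ideal.subscheme := fun i =>
    LocallyOfFiniteType.isLocallyNoetherian (M i).ideal.subschemeι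
  -- (M-c): the restricted blow-ups `ρ i : X (i+1) ⟶ X i`
  have hρex : ∀ i, ∃ ρ : (M (i + 1)).ideal.subscheme ⟶ (M i).ideal.subscheme,
      ρ ≫ (M i).ideal.subschemeι = (M (i + 1)).ideal.subschemeι ≫ π i ∧
        IsBlowup ρ (vanishingIdeal ⟨{xt i}, hxtcl i⟩) := by
    intro i
    haveI := hφoi i
    obtain ⟨ρ, hcomm, hbl⟩ := hMc K (c i).F (Z i) (Z (i + 1)) (M i) (M (i + 1)) (x i) (hx i) (φ i) (π i)
      (hmult i) (hord i) (hφ i) (hMφ i) (hπ i) (hMsucc i)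
    exact ⟨ρ, hcomm, hbl (xt i) (hxtcl i) (hιxt i)⟩
  choose ρ hρcomm hρbl using hρex
  have hρxt : ∀ i, (ρ i).base (xt (i + 1)) = xt i := by
    intro i
    apply (M i).ideal.subschemeι.isEmbedding.injective
    have h := congrArg (fun f => f.base (xt (i + 1))) (hρcomm i)
    simp only [Scheme.Hom.comp_base, TopCat.coe_comp, Function.comp_apply] at h
    exact h.trans (hπx i)
  -- the local schemes `S i = Spec 𝒪_{X_i, x̃ i}`
  have hc0 : ∀ i, (((M i).ideal.subscheme).fromSpecStalk (xt i)).base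
      (closedPoint (((M i).ideal.subscheme).presheaf.stalk (xt i))) = xt i :=
    fun i => Scheme.fromSpecStalk_closedPoint
  have hptcl : ∀ i, IsClosed ({closedPoint (((M i).ideal.subscheme).presheaf.stalk (xt i))} :
      Set ↥(Spec (((M i).ideal.subscheme).presheaf.stalk (xt i)))) :=
    fun i => isClosed_singleton_of_fromSpecStalk_eq (hc0 i)
  -- the base changes `B i`
  haveI hBln : ∀ i, IsLocallyNoetherian
      (pullback (ρ i) (((M i).ideal.subscheme).fromSpecStalk (xt i))) :=
    fun i => isLocallyNoetherian_pullback_fromSpecStalk (hρbl i) (xt i)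
  have hrad : ∀ i, vanishingIdeal (⟨{xt i}, hxtcl i⟩ : Closeds ↥((M i).ideal.subscheme)) =
      vanishingIdeal (vanishingIdeal (⟨{xt i}, hxtcl i⟩ : Closeds ↥((M i).ideal.subscheme))).support := by
    intro i
    rw [show (vanishingIdeal (⟨{xt i}, hxtcl i⟩ : Closeds ↥((M i).ideal.subscheme))).support =
      (⟨{xt i}, hxtcl i⟩ : Closeds ↥((M i).ideal.subscheme)) from
        SetLike.coe_injective (Scheme.IdealSheafData.coe_support_vanishingIdeal _)]
  have hmax : ∀ i, stalkIdeal (vanishingIdeal (⟨{xt i}, hxtcl i⟩ : Closeds ↥((M i).ideal.subscheme))) (xt i) =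
      maximalIdeal _ := fun i => stalkIdeal_vanishingIdeal_singleton (hxtcl i)
  have hbl' : ∀ i, IsBlowup (pullback.snd (ρ i) (((M i).ideal.subscheme).fromSpecStalk (xt i)))
      (vanishingIdeal ⟨{closedPoint (((M i).ideal.subscheme).presheaf.stalk (xt i))}, hptcl i⟩) :=
    fun i => isBlowup_pullback_snd_fromSpecStalk_singleton (hρbl i) (hrad i) (hmax i) (hc0 i)
  -- the lifts `b i` of `x̃ (i+1)`
  have hlift : ∀ i, ∃ b : ↥(pullback (ρ i) (((M i).ideal.subscheme).fromSpecStalk (xt i))),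
      (pullback.fst (ρ i) (((M i).ideal.subscheme).fromSpecStalk (xt i))).base b = xt (i + 1) ∧
        (((M i).ideal.subscheme).fromSpecStalk (xt i)).base
            ((pullback.snd (ρ i) (((M i).ideal.subscheme).fromSpecStalk (xt i))).base b) = xt i ∧
          IsIso ((pullback.fst (ρ i) (((M i).ideal.subscheme).fromSpecStalk (xt i))).stalkMap b) :=
    fun i => exists_lift_pullback_fromSpecStalk (ρ i) (xt i) (hρxt i)
  choose b hb hbs hbiso using hlift
  -- the stalk isomorphisms `𝒪_{B_i, b_i} ≅ 𝒪_{X_{i+1}, x̃_{i+1}}`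
  have hstalk : ∀ i, Nonempty ((pullback (ρ i) (((M i).ideal.subscheme).fromSpecStalk (xt i))).presheaf.stalk
      (b i) ≅ ((M (i + 1)).ideal.subscheme).presheaf.stalk (xt (i + 1))) := by
    intro i
    haveI := hbiso i
    exact ⟨(asIso ((pullback.fst (ρ i) (((M i).ideal.subscheme).fromSpecStalk (xt i))).stalkMap (b i))).symm ≪≫
      eqToIso (by rw [hb i])⟩
  -- the presentations of the hypersurface stalks
  have hpres : ∀ i, Nonempty (((M i).ideal.subscheme).presheaf.stalk (xt i) ≅ HypStalk K (c i).F) := by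
    intro i
    haveI := hφoi i
    exact exists_hypersurfaceStalkIso (M i) (φ i) (hφ i) (c i) (hMφ i) (xt i) (hιxt i)
  refine ⟨fun i => Spec (((M i).ideal.subscheme).presheaf.stalk (xt i)),
    fun i => pullback (ρ i) (((M i).ideal.subscheme).fromSpecStalk (xt i)), fun i => inferInstance, hBln,
    fun i => pullback.snd (ρ i) (((M i).ideal.subscheme).fromSpecStalk (xt i)),
    fun i => closedPoint (((M i).ideal.subscheme).presheaf.stalk (xt i)), b, hptcl, hbl', ?_, ?_, ?_, ?_, ?_, ?_⟩
  · -- `π' i (b i) = pt i`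
    exact fun i => eq_closedPoint_of_fromSpecStalk_eq (hbs i)
  · -- `b i` is closed: a specialization of `b i` lies over the closed point and over `x̃ (i+1)`
    intro i
    have hsnd : (pullback.snd (ρ i) (((M i).ideal.subscheme).fromSpecStalk (xt i))).base (b i) =
        closedPoint _ := eq_closedPoint_of_fromSpecStalk_eq (hbs i)
    have hcl : closure ({b i} : Set ↥(pullback (ρ i) (((M i).ideal.subscheme).fromSpecStalk (xt i)))) ⊆
        {b i} := by
      intro b' hb'
      have hbb' : b i ⤳ b' := specializes_iff_mem_closure.mpr hb'
      have h1 : xt (i + 1) ⤳ (pullback.fst (ρ i) (((M i).ideal.subscheme).fromSpecStalk (xt i))).base b' :=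
        hb i ▸ hbb'.map (pullback.fst (ρ i) (((M i).ideal.subscheme).fromSpecStalk (xt i))).continuous
      have h2 : (pullback.fst (ρ i) (((M i).ideal.subscheme).fromSpecStalk (xt i))).base b' = xt (i + 1) :=
        Set.mem_singleton_iff.mp (h1.mem_closed (hxtcl (i + 1)) rfl)
      have hinj : Function.Injective
          (pullback.fst (ρ i) (((M i).ideal.subscheme).fromSpecStalk (xt i))).base :=
        (pullback.fst (ρ i) (((M i).ideal.subscheme).fromSpecStalk (xt i))).isEmbedding.injective
      exact Set.mem_singleton_iff.mpr (hinj (h2.trans (hb i).symm))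
    exact isClosed_of_closure_subset hcl
  · -- `S (i+1)` is the local scheme of `B i` at `b i`
    intro i
    obtain ⟨e⟩ := hstalk i
    exact isLocalSchemeAt_Spec_of_iso e
  · -- `S i` is local at its closed point
    exact fun i => isLocalAt_Spec_closedPoint _
  · -- `S i` presented by `(c i).F`
    intro i
    obtain ⟨e⟩ := hpres i
    exact ⟨stalkClosedPointIso (((M i).ideal.subscheme).presheaf.stalk (xt i)) ≪≫ e⟩
  · -- `B i` presented by `(c (i+1)).F`
    intro i
    obtain ⟨e₁⟩ := hstalk i
    obtain ⟨e₂⟩ := hpres (i + 1)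
    exact ⟨e₁ ≪≫ e₂⟩

end Localize

end E2OfCJS

end Summit.ResolutionOfSingularities.ResolutionOfSingularities.Theorems.PIDim4

end
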